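import Summits.CriticalPhenomena.Ising3DConformalLimit.Theses.CoerciveSharpness
import Summits.CriticalPhenomena.Ising3DConformalLimit.Theorems.LatticeSDPCertificatesWindowBelowHalf
import Summits.CriticalPhenomena.Ising3DConformalLimit.Theorems.CoerciveSharpnessWindowOfGrowthStubDenominatorLe
import Summits.CriticalPhenomena.Ising3DConformalLimit.Theorems.CoerciveSharpnessWindowOfGrowthStubReflGradLeMajorant
import Literature.Probability.LatticeModels.CriticalTwoPointDCPLowerProofs
import Literature.Probability.LatticeModels.CriticalEtaUpperDCPProofs
import HarnessLib

/-!
# Route `CoerciveSharpness`, crux `WindowOfGrowth` (item stmt-CriticalPhenomena-18198): proof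
# along the line `eta_deficit`

Closing file of the crux: `theorem windowOfGrowth_proof :
Summit.CriticalPhenomena.Ising3DConformalLimit.Theses.CoerciveSharpness.WindowOfGrowth`.
It is the registered skeleton `Cruxes/WindowOfGrowth/Lines/eta_deficit.lean` (crux-strategist
planner-cstrat-stmt-CriticalPhenomena-18198-b1-0) with its two registered stubs PROVED
(`stub_reflGrad_le_majorant`, `stub_denominator_le`, verbatim signatures, helper namespace
`…Theorems.CoerciveSharpnessWindowOfGrowth`, files `Theorems/CoerciveSharpnessWindowOfGrowthStubReflGradLeMajorant.lean`
and `Theorems/CoerciveSharpnessWindowOfGrowthStubDenominatorLe.lean`) and composed here exactly as in the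
skeleton's `WindowOfGrowth_of` (tree-visible sorry-free companion: `Cruxes/WindowOfGrowth/Lines/eta_deficit_complete.lean`).

Mathematics (Duminil-Copin–Panis, CMP 406 (2025) = arXiv:2404.05700, proof of Thm 1.3 p. 5 and of Thm 1.5
p. 6, run pointwise in the scale with the extra growth factor): with `b = min η 3/4`,
`c₀ (4n)^{κ'} ≤ Q(4n) ≤ 6 Σ_{Λ_{4n}} majorant ≤ 5838·C·(1+872C)·n^{1-2b}` for all large `n`, hence
`κ' + 2b ≤ 1`, `b = η ≤ (1-κ')/2 < 1/2`, and WINDOW by `windowBelowHalf_of_hasIsingEtaBounds`.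
Inputs (all theorems of the tree): `DCP.term_le_of_le`, `DCP.term_le_of_lt`, `DCP.majorant_nonneg`,
`DCP.sum_majorant_le`, `DCP.twoPointFree_criticalBeta_eq`, `DCP.freeExpect_spinPair_dcpReflect`
(`CriticalTwoPointDCPLowerProofs`), `sum_box_erase_norm_rpow_le`, `sum_Icc_rpow_sub_one_le`
(`CriticalEtaUpperDCPProofs`), `criticalTwoPoint_bounds_holds`, `twoPointPlus_origin`,
`Summit.CriticalPhenomena.Ising3DConformalLimit.Theorems.windowBelowHalf_of_hasIsingEtaBounds`.
No definition, no notation, no named fact as hypothesis.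
-/

noncomputable section

namespace Summit.CriticalPhenomena.Ising3DConformalLimit.Theorems

namespace CoerciveSharpnessWindowOfGrowth

open Filter

/-! ### Proved glue -/

/-- If `c n^a ≤ C` for all large `n` with `c > 0`, then `a ≤ 0`. [folklore] -/
theorem exponent_nonpos_of_bounded {a c C : ℝ} {N : ℕ} (hc : 0 < c)
    (h : ∀ n : ℕ, N ≤ n → c * (n : ℝ) ^ a ≤ C) : a ≤ 0 := by
  by_contra ha
  have ha' : 0 < a := lt_of_not_ge ha
  have hlim : Tendsto (fun n : ℕ => c * (n : ℝ) ^ a) atTop atTop :=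
    Tendsto.const_mul_atTop hc ((tendsto_rpow_atTop ha').comp tendsto_natCast_atTop_atTop)
  obtain ⟨n, hn1, hn2⟩ := ((hlim.eventually_gt_atTop C).and (eventually_ge_atTop N)).exists
  exact absurd (h n hn2) (not_le.2 hn1)

/-- The real-variable bookkeeping of the composition: with `G_n ≤ C A`, `χ ≤ D U`,
`1 + 2K ≤ 3DU/t`, `P ≤ 81 t²` (all quantities nonnegative, `t > 0`),
`G_n χ + (4 G_n / t) P (1 + 2K) ≤ 973 · C D · A U`. [folklore] -/
theorem majorant_algebra {Gn χ K P t A U C D : ℝ} (ht : 0 < t) (hA : 0 ≤ A) (hU : 0 ≤ U)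
    (hC : 0 ≤ C) (hD : 0 ≤ D) (hGn0 : 0 ≤ Gn) (hGn : Gn ≤ C * A) (hχ0 : 0 ≤ χ) (hχ : χ ≤ D * U)
    (hK0 : 0 ≤ K) (hK : 1 + 2 * K ≤ 3 * D * U / t) (hP0 : 0 ≤ P) (hP : P ≤ 81 * t ^ 2) :
    Gn * χ + 4 * Gn / t * P * (1 + 2 * K) ≤ 973 * (C * D * (A * U)) := by
  have h1 : Gn * χ ≤ (C * A) * (D * U) := mul_le_mul hGn hχ hχ0 (by positivity)
  have ha : 4 * Gn / t ≤ 4 * (C * A) / t :=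
    div_le_div_of_nonneg_right (by linarith) ht.le
  have hb : 0 ≤ 4 * Gn / t := by positivity
  have hK1 : 0 ≤ 1 + 2 * K := by positivity
  have h2 : 4 * Gn / t * P * (1 + 2 * K) ≤ 4 * (C * A) / t * (81 * t ^ 2) * (3 * D * U / t) :=
    mul_le_mul (mul_le_mul ha hP hP0 (by positivity)) hK hK1 (by positivity)
  have h3 : 4 * (C * A) / t * (81 * t ^ 2) * (3 * D * U / t) = 972 * (C * D * (A * U)) := by
    field_simp
    ring
  have h4 : 0 ≤ C * D * (A * U) := by positivity
  linarith [h1, h2, h3, h4]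

end CoerciveSharpnessWindowOfGrowth

/-! ### The composition: the two stubs imply the crux BY NAME -/

open scoped BigOperators
open Filter Finset
open Literature.Probability.LatticeModels
open CoerciveSharpnessWindowOfGrowth

/-- **The crux `CoerciveSharpness.WindowOfGrowth` (item stmt-CriticalPhenomena-18198), proved** along the
line `eta_deficit`: growth `n^{κ'}` of the reflected gradient and two-sided `η`-bounds force
`η ≤ (1-κ')/2 < 1/2` (Duminil-Copin–Panis Thm 1.3/1.5 run pointwise in the scale), hence the all-scale
WINDOW (`windowBelowHalf_of_hasIsingEtaBounds`). [cite: DuminilCopinPanis2025LowerBounds, Theorems 1.3, 1.5 and their proofs (arXiv pp. 5–6)] -/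
theorem windowOfGrowth_proof :
    Summit.CriticalPhenomena.Ising3DConformalLimit.Theses.CoerciveSharpness.WindowOfGrowth := by
  unfold Summit.CriticalPhenomena.Ising3DConformalLimit.Theses.CoerciveSharpness.WindowOfGrowth
  have h1 := stub_reflGrad_le_majorant
  have h2 := stub_denominator_le
  intro hA hE
  obtain ⟨κ', c₀, hκ', hc₀, N₀, hgrow⟩ := hA
  obtain ⟨η, hη⟩ := hE
  -- the tree's summed majorant bound (DC–Panis, proof of Thm 1.3), at `d = 3`, axis `e₁`
  have hsum : ∀ n : ℕ, 1 ≤ n → (∑ x ∈ box 3 (4 * n),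
        (if x 0 ≤ 2 * (n : ℤ) then
            criticalTwoPoint 3 x * criticalTwoPoint 3 (Pi.single 0 (n : ℤ))
         else 4 * ((((4 * n : ℕ) : ℤ) - x 0 : ℤ) : ℝ) / n * criticalTwoPoint 3 (Pi.single 0 (n : ℤ)) *
           criticalTwoPoint 3 (Pi.single 0 (((4 * n : ℕ) : ℤ) - x 0 - 1)))) ≤
      criticalTwoPoint 3 (Pi.single 0 (n : ℤ)) * (∑ x ∈ box 3 (4 * n), criticalTwoPoint 3 x) +
        4 * criticalTwoPoint 3 (Pi.single 0 (n : ℤ)) / n * ((2 * (4 * n : ℕ) + 1 : ℕ) : ℝ) ^ 2 *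
          (1 + 2 * ∑ k ∈ Finset.Icc 1 (2 * n), (k : ℝ) * criticalTwoPoint 3 (Pi.single 0 (k : ℤ))) :=
    fun n hn => DCP.sum_majorant_le (d' := 2) (0 : Fin 3) hn
  -- it suffices to show `η < 1/2` (the tree turns two-sided bounds with `η < 1/2` into WINDOW)
  refine Summit.CriticalPhenomena.Ising3DConformalLimit.Theorems.windowBelowHalf_of_hasIsingEtaBounds
    ?_ hη
  -- unpack the two-sided bounds
  have hη' := hη
  unfold HasIsingEtaBounds IsPowerBounded at hη'
  obtain ⟨c, C, hc, hbd⟩ := hη'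
  have he : (-(((3 : ℕ) : ℝ) - 2 + η)) = -(1 + η) := by norm_num
  have hlow : ∀ x : Site 3, x ≠ 0 → c * ‖x‖ ^ (-(1 + η)) ≤ criticalTwoPoint 3 x := fun x hx => by
    have h := (hbd x hx).1; rwa [he] at h
  have hupp : ∀ x : Site 3, x ≠ 0 → criticalTwoPoint 3 x ≤ C * ‖x‖ ^ (-(1 + η)) := fun x hx => by
    have h := (hbd x hx).2; rwa [he] at h
  -- basic facts on `G = criticalTwoPoint 3`
  have hG0 : ∀ x : Site 3, 0 ≤ criticalTwoPoint 3 x := fun x => DCP.critS_nonneg (d' := 2) x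
  have hG00 : criticalTwoPoint 3 0 = 1 := twoPointPlus_origin (d := 3) _
  have hne : ∀ k : ℕ, 1 ≤ k → (Pi.single (0 : Fin 3) (k : ℤ) : Site 3) ≠ 0 := by
    intro k hk h
    have h0 := congr_fun h 0
    simp at h0
    omega
  have hnorm : ∀ k : ℕ, ‖(Pi.single (0 : Fin 3) (k : ℤ) : Site 3)‖ = k := fun k => by
    rw [Pi.norm_single, Int.norm_natCast]
  -- `C > 0` (at `x = e₁`: `c ≤ G(e₁) ≤ C`)
  have hCpos : 0 < C := by
    have h1' := hlow _ (hne 1 le_rfl)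
    have h2' := hupp _ (hne 1 le_rfl)
    rw [hnorm 1] at h1' h2'
    norm_num at h1' h2'
    linarith
  -- `η ≥ 0` from the infrared bound `G ≤ C' ‖x‖⁻¹`
  obtain ⟨c', C', hc', hbnd'⟩ := criticalTwoPoint_bounds_holds (d := 3) (by norm_num)
  have hη0 : 0 ≤ η := by
    have key : ∀ k : ℕ, 1 ≤ k → c * (k : ℝ) ^ (-η) ≤ C' := by
      intro k hk
      have hkpos : (0 : ℝ) < k := by exact_mod_cast hk
      have hl := hlow _ (hne k hk)
      have hu := (hbnd' _ (hne k hk)).2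
      rw [hnorm k] at hl hu
      rw [show -(((3 : ℕ) : ℝ) - 2) = -(1 : ℝ) by norm_num] at hu
      have hchain : c * (k : ℝ) ^ (-(1 + η)) ≤ C' * (k : ℝ) ^ (-(1 : ℝ)) := hl.trans hu
      have hmul := mul_le_mul_of_nonneg_right hchain (Real.rpow_nonneg hkpos.le (1 : ℝ))
      have e1 : c * (k : ℝ) ^ (-(1 + η)) * (k : ℝ) ^ (1 : ℝ) = c * (k : ℝ) ^ (-η) := by
        rw [mul_assoc, ← Real.rpow_add hkpos]; congr 1; ring_nf
      have e2 : C' * (k : ℝ) ^ (-(1 : ℝ)) * (k : ℝ) ^ (1 : ℝ) = C' := by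
        rw [mul_assoc, ← Real.rpow_add hkpos, show -(1 : ℝ) + 1 = 0 by ring, Real.rpow_zero, mul_one]
      rw [e1, e2] at hmul
      exact hmul
    have := exponent_nonpos_of_bounded (N := 1) hc key
    linarith
  -- the auxiliary exponent `b = min η 3/4 ∈ [0, 3/4]`, `b ≤ η`
  set b : ℝ := min η (3 / 4) with hb_def
  have hb0 : 0 ≤ b := le_min hη0 (by norm_num)
  have hb34 : b ≤ 3 / 4 := min_le_right _ _
  have hbη : b ≤ η := min_le_left _ _
  -- the upper bound with exponent `1 + b`
  have hup : ∀ x : Site 3, x ≠ 0 → criticalTwoPoint 3 x ≤ C * ‖x‖ ^ (-(1 + b)) := by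
    intro x hx
    have hx1 : (1 : ℝ) ≤ ‖x‖ := by
      have h := norm_pos_iff.2 hx
      rw [Site.norm_eq_supNorm] at h ⊢
      exact_mod_cast Nat.one_le_iff_ne_zero.2 (by exact_mod_cast h.ne')
    refine (hupp x hx).trans (mul_le_mul_of_nonneg_left ?_ hCpos.le)
    exact Real.rpow_le_rpow_of_exponent_le hx1 (by linarith)
  -- the denominator bound (stub 2) for `F = G`, `K = C`
  have hden := h2 (criticalTwoPoint 3) C b hCpos hb0 hb34 hG00 hup
  -- abbreviation for the constant
  have hD1 : (1 : ℝ) ≤ 1 + 872 * C := by linarith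
  have hD0 : (0 : ℝ) ≤ 1 + 872 * C := by linarith
  -- MAIN ESTIMATE: for `n ≥ max N₀ 1`, `c₀ n^{κ'} ≤ 5838 C (1+872C) n^{1-2b}`
  have key : ∀ n : ℕ, max N₀ 1 ≤ n →
      c₀ * (n : ℝ) ^ (κ' - (1 - 2 * b)) ≤ 5838 * C * (1 + 872 * C) := by
    intro n hn
    have hnN : N₀ ≤ n := le_of_max_le_left hn
    have hn1 : 1 ≤ n := le_of_max_le_right hn
    have ht : (0 : ℝ) < n := by exact_mod_cast hn1
    have ht1 : (1 : ℝ) ≤ n := by exact_mod_cast hn1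
    -- growth at scale `4n`, then stub 1, then the summed majorant
    have hQ := (hgrow (4 * n) (by omega)).trans (h1 n hn1)
    have hS := hsum n hn1
    have hDen := hden n hn1
    -- the pieces
    have hGn0 : 0 ≤ criticalTwoPoint 3 (Pi.single 0 (n : ℤ)) := hG0 _
    have hGn : criticalTwoPoint 3 (Pi.single 0 (n : ℤ)) ≤ C * (n : ℝ) ^ (-(1 + b)) := by
      have := hup _ (hne n hn1)
      rwa [hnorm n] at this
    have hχ0 : 0 ≤ ∑ x ∈ box 3 (4 * n), criticalTwoPoint 3 x := sum_nonneg fun x _ => hG0 x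
    have hK0 : 0 ≤ ∑ k ∈ Finset.Icc 1 (2 * n), (k : ℝ) * criticalTwoPoint 3 (Pi.single 0 (k : ℤ)) :=
      sum_nonneg fun k _ => mul_nonneg (Nat.cast_nonneg k) (hG0 _)
    have hU0 : 0 ≤ (n : ℝ) ^ (2 - b) := Real.rpow_nonneg ht.le _
    have hA0 : 0 ≤ (n : ℝ) ^ (-(1 + b)) := Real.rpow_nonneg ht.le _
    have hχ : ∑ x ∈ box 3 (4 * n), criticalTwoPoint 3 x ≤ (1 + 872 * C) * (n : ℝ) ^ (2 - b) := by
      have : 0 ≤ (n : ℝ) * ∑ k ∈ Finset.Icc 1 (2 * n), (k : ℝ) * criticalTwoPoint 3 (Pi.single 0 (k : ℤ)) :=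
        mul_nonneg ht.le hK0
      linarith
    -- `t ≤ t^{2-b}` hence `1 ≤ (1+872C) t^{2-b} / t`
    have htU : (n : ℝ) ≤ (n : ℝ) ^ (2 - b) := by
      have := Real.rpow_le_rpow_of_exponent_le ht1 (show (1 : ℝ) ≤ 2 - b by linarith)
      rwa [Real.rpow_one] at this
    have hK : 1 + 2 * ∑ k ∈ Finset.Icc 1 (2 * n), (k : ℝ) * criticalTwoPoint 3 (Pi.single 0 (k : ℤ)) ≤
        3 * (1 + 872 * C) * (n : ℝ) ^ (2 - b) / n := by
      rw [le_div_iff₀ ht]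
      have hKn : (n : ℝ) * ∑ k ∈ Finset.Icc 1 (2 * n), (k : ℝ) * criticalTwoPoint 3 (Pi.single 0 (k : ℤ)) ≤
          (1 + 872 * C) * (n : ℝ) ^ (2 - b) := by linarith
      have h1n : (n : ℝ) ≤ (1 + 872 * C) * (n : ℝ) ^ (2 - b) := by nlinarith
      nlinarith
    have hP0 : 0 ≤ ((2 * (4 * n : ℕ) + 1 : ℕ) : ℝ) ^ 2 := by positivity
    have hP : ((2 * (4 * n : ℕ) + 1 : ℕ) : ℝ) ^ 2 ≤ 81 * (n : ℝ) ^ 2 := by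
      push_cast
      nlinarith
    have hmaj := majorant_algebra ht hA0 hU0 hCpos.le hD0 hGn0 hGn hχ0 hχ hK0 hK hP0 hP
    -- `A U = t^{1-2b}`
    have hAU : (n : ℝ) ^ (-(1 + b)) * (n : ℝ) ^ (2 - b) = (n : ℝ) ^ (1 - 2 * b) := by
      rw [← Real.rpow_add ht]; congr 1; ring
    rw [hAU] at hmaj
    -- chain: `c₀ (4n)^{κ'} ≤ 6 Σ maj ≤ 6 (…) ≤ 6 · 973 · C D t^{1-2b}`
    have hchain : c₀ * ((4 * n : ℕ) : ℝ) ^ κ' ≤ 6 * (973 * (C * (1 + 872 * C) * (n : ℝ) ^ (1 - 2 * b))) :=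
      hQ.trans ((mul_le_mul_of_nonneg_left hS (by norm_num)).trans
        (mul_le_mul_of_nonneg_left hmaj (by norm_num)))
    -- `n^{κ'} ≤ (4n)^{κ'}`
    have h4n : c₀ * (n : ℝ) ^ κ' ≤ c₀ * ((4 * n : ℕ) : ℝ) ^ κ' := by
      refine mul_le_mul_of_nonneg_left ?_ hc₀.le
      exact Real.rpow_le_rpow ht.le (by push_cast; linarith) hκ'.le
    -- divide by `n^{1-2b}`
    have hpow0 : 0 < (n : ℝ) ^ (1 - 2 * b) := Real.rpow_pos_of_pos ht _
    have hsplit : (n : ℝ) ^ (κ' - (1 - 2 * b)) = (n : ℝ) ^ κ' / (n : ℝ) ^ (1 - 2 * b) := by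
      rw [Real.rpow_sub ht]
    rw [hsplit, mul_div_assoc', div_le_iff₀ hpow0]
    calc c₀ * (n : ℝ) ^ κ' ≤ 6 * (973 * (C * (1 + 872 * C) * (n : ℝ) ^ (1 - 2 * b))) := h4n.trans hchain
      _ = 5838 * C * (1 + 872 * C) * (n : ℝ) ^ (1 - 2 * b) := by ring
  -- hence `κ' ≤ 1 - 2b`, i.e. `b ≤ (1 - κ')/2 < 1/2`, so `b = η` and `η < 1/2`
  have hexp := exponent_nonpos_of_bounded hc₀ key
  have hb12 : b < 1 / 2 := by linarith
  by_cases hη34 : η ≤ 3 / 4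
  · have : b = η := min_eq_left hη34
    linarith
  · exfalso
    have : b = 3 / 4 := min_eq_right (by linarith)
    linarith

end Summit.CriticalPhenomena.Ising3DConformalLimit.Theorems
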